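import Literature.Probability.RandomPlanarGeometry.SAWCountZdSymbolSecondLowerCount
import HarnessLib

/-!
# THE BLOCK-COUNT RECURRENCE: `#twoParts` is the associated Stirling number of the second kind — `T(n+2, k+1) = (k+1)·T(n+1, k+1) + (n+1)·T(n, k)`

Topic `Literature/Probability/RandomPlanarGeometry` (the «SYMBOL POLYNOMIALITY» programme for `c_n(ℤ^d)`; infrastructure for EVERY layer: on `SAWCountZdSymbolSecondLowerCount.lean`
(a-p1 g26: `twoParts W k` = the set partitions of `W` into `k` blocks of size `≥ 2`, (G0)/(G1)/(G2)), the set-partition API of `HardCoreUrsell.lean` (`IsSetPartition`, `blockOf`,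
`.erase`, `.insert`)).

PRINTED CONTEXT (locators only). Charalambides (2018) Ch. 2 Exercise 32: the number `S₂(n, r)` of partitions of an `n`-set into `r` blocks of size `≥ 2` — the ASSOCIATED STIRLING
NUMBER OF THE SECOND KIND; its triangular recurrence `S₂(n+1, r) = r·S₂(n, r) + n·S₂(n−1, r−1)` (classify by the block of the last point: it joins one of the `r` blocks of a
partition of the others, or it forms a pair with one of the `n` other points) is classical (Comtet 1974 §5.7). Madras–Slade (1993) Definition 1.2.4 (the lane's use: the (A, B, ρ)
coordinates of the lower corners of every layer of the `1/d` symbol need `#twoParts` on `2k + e` points for the `e`-th layer — (G1)…(G4) so far, one file each).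

THE THEOREM. ★★ `card_twoParts_insert`: for `a ∉ W`, **`#twoParts (insert a W) (k+1) = (k+1)·#twoParts W (k+1) + Σ_{i ∈ W} #twoParts (W.erase i) k`** (bijections: remove `a`
from a block of size `≥ 3` ↔ (partition of `W`, marked block); remove the pair `{a, i}` ↔ (`i`, partition of `W ∖ {i}` into `k` blocks));
★★★ `card_twoParts_eq_assocStirling`:
**`#twoParts W k = T(#W, k)`** for the recursively defined `assocStirling` (`T(0,0) = 1`, `T(n+2, k+1) = (k+1)T(n+1, k+1) + (n+1)T(n, k)`, zero otherwise) — ALL the lane's block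
counts (G_e) at once: ★ `assocStirling_values` checks `T(2k+e, k)` against (G1)…(G4) of the tree for `k ≤ 4`
(`(2k−1)‼`; `C(2k+1,3)(2k−3)‼`; `C(2k+2,4)(2k−3)‼ + 10C(2k+2,6)(2k−5)‼`; `C(2k+3,5)(2k−3)‼ + C(2k+3,4)C(2k−1,3)(2k−5)‼ + 280C(2k+3,9)(2k−7)‼`) and
tabulates the FIFTH-layer inputs `T(2k+4, k) = 1, 119, 6825, 302995, 12122110` (`k = 1…5`).
Tool notion (the lane's): `assocStirling`.

THIS FILE (lane «pcv-sawmu», a-p1 g27; all PROVED, standard axioms): `assocStirling` (+ `assocStirling_zero_zero`, `_zero_succ`, `_succ_zero`, `_one_succ`, `_succ_succ`),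
`card_twoParts_zero_right`, `insert_sdiff_eq_sdiff_erase` (private), `mem_twoParts_removeFrom` (private), `mem_twoParts_addTo` (private), ★ `card_twoParts_filter_three_le`,
★ `card_twoParts_filter_pair`, ★★ `card_twoParts_insert`, ★★★ `card_twoParts_eq_assocStirling`, ★ `assocStirling_values`.
[cite: Charalambides2018, Ch. 2 Exercise 32 (associated Stirling numbers of the second kind)] [cite: MadrasSlade1993, Definition 1.2.4] [cite: Stanley2012EC1, §1.3]

Provenance: lane «pcv-sawmu», a-p1 g27 (2026-08-28).
-/

open Finset
open scoped BigOperators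
open Literature.Probability.LatticeModels
open Literature.Probability.RandomPlanarGeometry.SAW
open Literature.Probability.Percolation
open Literature.MathematicalPhysics.QuantumFieldTheory.Balaban1983to89
open Literature.MathematicalPhysics.QuantumFieldTheory.Balaban1983to89.HiggsFluctMeasureWickPairings

namespace Literature.Probability.RandomPlanarGeometry.SAW.Zd

namespace WordTypes

variable {m : ℕ}

/-! ### The associated Stirling numbers of the second kind -/

/-- The ASSOCIATED STIRLING NUMBER OF THE SECOND KIND `T(n, k)`: partitions of `n` points into `k` blocks of size `≥ 2`, by the triangular recurrence
`T(n+2, k+1) = (k+1)·T(n+1, k+1) + (n+1)·T(n, k)`, `T(0, 0) = 1`. [cite: Charalambides2018, Ch. 2 Exercise 32 (associated Stirling numbers of the second kind); lane tool notion] -/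
def assocStirling : ℕ → ℕ → ℕ
  | 0, 0 => 1
  | 0, _ + 1 => 0
  | _ + 1, 0 => 0
  | 1, _ + 1 => 0
  | n + 2, k + 1 => (k + 1) * assocStirling (n + 1) (k + 1) + (n + 1) * assocStirling n k

/-- `T(0, 0) = 1`. [cite: Charalambides2018, Ch. 2 Exercise 32; lane plumbing] -/
theorem assocStirling_zero_zero : assocStirling 0 0 = 1 := by simp [assocStirling]

/-- `T(0, k+1) = 0`. [cite: Charalambides2018, Ch. 2 Exercise 32; lane plumbing] -/
theorem assocStirling_zero_succ (k : ℕ) : assocStirling 0 (k + 1) = 0 := by simp [assocStirling]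

/-- `T(n+1, 0) = 0`. [cite: Charalambides2018, Ch. 2 Exercise 32; lane plumbing] -/
theorem assocStirling_succ_zero (n : ℕ) : assocStirling (n + 1) 0 = 0 := by
  cases n <;> simp [assocStirling]

/-- `T(1, k+1) = 0`. [cite: Charalambides2018, Ch. 2 Exercise 32; lane plumbing] -/
theorem assocStirling_one_succ (k : ℕ) : assocStirling 1 (k + 1) = 0 := by simp [assocStirling]

/-- The recurrence `T(n+2, k+1) = (k+1)·T(n+1, k+1) + (n+1)·T(n, k)`. [cite: Charalambides2018, Ch. 2 Exercise 32; lane plumbing] -/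
theorem assocStirling_succ_succ (n k : ℕ) : assocStirling (n + 2) (k + 1) = (k + 1) * assocStirling (n + 1) (k + 1) + (n + 1) * assocStirling n k := by
  simp [assocStirling]

/-! ### No blocks -/

/-- `#twoParts W 0 = [W = ∅]`. [cite: MadrasSlade1993, Definition 1.2.4; lane plumbing] -/
theorem card_twoParts_zero_right (W : Finset (Fin m)) : (twoParts W 0).card = if W = ∅ then 1 else 0 := by
  split_ifs with h
  · rw [card_twoParts_of_card_eq (k := 0) (by rw [h]; rfl)]; rfl
  · rw [Finset.card_eq_zero, Finset.eq_empty_iff_forall_notMem]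
    intro ρ hρ
    rw [mem_twoParts] at hρ
    obtain ⟨hρ, -, h0⟩ := hρ
    obtain ⟨v, hv⟩ := Finset.nonempty_iff_ne_empty.2 h
    obtain ⟨P, hP, -⟩ := hρ.exists_mem hv
    rw [Finset.card_eq_zero.1 h0] at hP
    simp at hP

/-! ### Element surgery on a block -/

/-- `(insert a W) ∖ B = W ∖ (B.erase a)` when `a ∈ B`, `a ∉ W`. [cite: Stanley2012EC1, §1.3; lane plumbing] -/
private theorem insert_sdiff_eq_sdiff_erase {W B : Finset (Fin m)} {a : Fin m} (haW : a ∉ W) (haB : a ∈ B) : insert a W \ B = W \ B.erase a := by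
  ext x
  simp only [Finset.mem_sdiff, Finset.mem_insert, Finset.mem_erase, not_and]
  constructor
  · rintro ⟨hx | hx, hxB⟩
    · rw [hx] at hxB; exact absurd haB hxB
    · exact ⟨hx, fun _ => hxB⟩
  · rintro ⟨hx, h⟩
    refine ⟨Or.inr hx, fun hxB => h ?_ hxB⟩
    rintro rfl; exact haW hx

/-- Removing `a` from its block `B` (of size `≥ 3`): `insert (B.erase a) (ρ.erase B) ∈ twoParts W (k+1)`. [cite: Stanley2012EC1, §1.3; lane plumbing] -/
private theorem mem_twoParts_removeFrom {W : Finset (Fin m)} {a : Fin m} (haW : a ∉ W) {k : ℕ} {ρ : Finset (Finset (Fin m))} (hρ : ρ ∈ twoParts (insert a W) (k + 1))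
    {B : Finset (Fin m)} (hB : B ∈ ρ) (haB : a ∈ B) (hB3 : 3 ≤ B.card) :
    insert (B.erase a) (ρ.erase B) ∈ twoParts W (k + 1) ∧ B.erase a ∉ ρ.erase B := by
  rw [mem_twoParts] at hρ ⊢
  obtain ⟨hρ, h2, hk⟩ := hρ
  have h1 : IsSetPartition (W \ B.erase a) (ρ.erase B) := by rw [← insert_sdiff_eq_sdiff_erase haW haB]; exact hρ.erase hB
  have hne : (B.erase a).Nonempty := by rw [← Finset.card_pos, Finset.card_erase_of_mem haB]; omega
  have hBW : B.erase a ⊆ W := fun x hx => by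
    rw [Finset.mem_erase] at hx
    have := hρ.subset hB hx.2
    rw [Finset.mem_insert] at this
    exact this.resolve_left hx.1
  have hnot : B.erase a ∉ ρ.erase B := h1.notMem_of_sdiff hne
  refine ⟨⟨h1.insert hBW hne, fun C hC => ?_, by rw [Finset.card_insert_of_notMem hnot, Finset.card_erase_of_mem hB, hk]; omega⟩, hnot⟩
  rcases Finset.mem_insert.1 hC with rfl | hC
  · rw [Finset.card_erase_of_mem haB]; omega
  · exact h2 C (Finset.mem_of_mem_erase hC)

/-- Adding `a ∉ W` to a block `C ∈ σ`: `insert (insert a C) (σ.erase C) ∈ twoParts (insert a W) (k+1)`, and `insert a C` is the block of `a`. [cite: Stanley2012EC1, §1.3; lane plumbing] -/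
private theorem mem_twoParts_addTo {W : Finset (Fin m)} {a : Fin m} (haW : a ∉ W) {k : ℕ} {σ : Finset (Finset (Fin m))} (hσ : σ ∈ twoParts W (k + 1))
    {C : Finset (Fin m)} (hC : C ∈ σ) :
    insert (insert a C) (σ.erase C) ∈ twoParts (insert a W) (k + 1) ∧ insert a C ∉ σ.erase C ∧ a ∉ C ∧
      blockOf (insert (insert a C) (σ.erase C)) a = insert a C := by
  rw [mem_twoParts] at hσ ⊢
  obtain ⟨hσ, h2, hk⟩ := hσ
  have haC : a ∉ C := fun h => haW (hσ.subset hC h)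
  have h1 : IsSetPartition (insert a W \ insert a C) (σ.erase C) := by
    rw [insert_sdiff_eq_sdiff_erase haW (Finset.mem_insert_self a C), Finset.erase_insert haC]; exact hσ.erase hC
  have hne : (insert a C).Nonempty := Finset.insert_nonempty _ _
  have hnot : insert a C ∉ σ.erase C := h1.notMem_of_sdiff hne
  have hsub : insert a C ⊆ insert a W := Finset.insert_subset_insert _ (hσ.subset hC)
  have hpart : IsSetPartition (insert a W) (insert (insert a C) (σ.erase C)) := h1.insert hsub hne
  refine ⟨⟨hpart, fun D hD => ?_, by rw [Finset.card_insert_of_notMem hnot, Finset.card_erase_of_mem hC, hk]; omega⟩, hnot, haC,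
    hpart.eq_blockOf (Finset.mem_insert_self _ _) (Finset.mem_insert_self _ _)⟩
  rcases Finset.mem_insert.1 hD with rfl | hD
  · rw [Finset.card_insert_of_notMem haC]; have := h2 C hC; omega
  · exact h2 D (Finset.mem_of_mem_erase hD)

/-! ### The two bijections -/

open Classical in
/-- ★ `a` in a block of size `≥ 3`: `#{ρ ∈ twoParts (insert a W) (k+1) | 3 ≤ #blockOf ρ a} = (k+1)·#twoParts W (k+1)` — remove `a`, remember the block.
[cite: Charalambides2018, Ch. 2 Exercise 32; lane lemma] -/
theorem card_twoParts_filter_three_le {W : Finset (Fin m)} {a : Fin m} (haW : a ∉ W) (k : ℕ) :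
    ((twoParts (insert a W) (k + 1)).filter fun ρ => 3 ≤ (blockOf ρ a).card).card = (k + 1) * (twoParts W (k + 1)).card := by
  have htarget : ((twoParts W (k + 1)).sigma fun σ => σ).card = (k + 1) * (twoParts W (k + 1)).card := by
    rw [Finset.card_sigma, Finset.sum_const_nat (m := k + 1) (fun σ hσ => (mem_twoParts.1 hσ).2.2), mul_comm]
  rw [← htarget]
  refine Finset.card_nbij' (fun ρ => ⟨insert ((blockOf ρ a).erase a) (ρ.erase (blockOf ρ a)), (blockOf ρ a).erase a⟩) (fun d => insert (insert a d.2) (d.1.erase d.2))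
    (fun ρ hρ => ?_) (fun d hd => ?_) (fun ρ hρ => ?_) (fun d hd => ?_)
  · rw [Finset.mem_coe, Finset.mem_filter] at hρ
    obtain ⟨hρ, h3⟩ := hρ
    have hpart := (mem_twoParts.1 hρ).1
    have hB := hpart.blockOf_mem (Finset.mem_insert_self a W)
    have haB := hpart.mem_blockOf (Finset.mem_insert_self a W)
    obtain ⟨hmem, -⟩ := mem_twoParts_removeFrom haW hρ hB haB h3
    rw [Finset.mem_coe, Finset.mem_sigma]
    exact ⟨hmem, Finset.mem_insert_self _ _⟩
  · rw [Finset.mem_coe, Finset.mem_sigma] at hd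
    obtain ⟨hσ, hC⟩ := hd
    obtain ⟨hmem, -, haC, hblock⟩ := mem_twoParts_addTo haW hσ hC
    rw [Finset.mem_coe, Finset.mem_filter]
    refine ⟨hmem, ?_⟩
    have := (mem_twoParts.1 hσ).2.1 d.2 hC
    simp only [hblock, Finset.card_insert_of_notMem haC]
    omega
  · rw [Finset.mem_coe, Finset.mem_filter] at hρ
    obtain ⟨hρ, h3⟩ := hρ
    have hpart := (mem_twoParts.1 hρ).1
    have hB := hpart.blockOf_mem (Finset.mem_insert_self a W)
    have haB := hpart.mem_blockOf (Finset.mem_insert_self a W)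
    obtain ⟨-, hnot⟩ := mem_twoParts_removeFrom haW hρ hB haB h3
    dsimp only
    rw [Finset.insert_erase haB, Finset.erase_insert hnot, Finset.insert_erase hB]
  · rw [Finset.mem_coe, Finset.mem_sigma] at hd
    obtain ⟨hσ, hC⟩ := hd
    obtain ⟨-, hnot, haC, hblock⟩ := mem_twoParts_addTo haW hσ hC
    simp only [hblock, Finset.erase_insert haC, Finset.erase_insert hnot, Finset.insert_erase hC]

open Classical in
/-- ★ `a` in a pair `{a, i}`: `#{ρ ∈ twoParts (insert a W) (k+1) | #blockOf ρ a = 2} = Σ_{i ∈ W} #twoParts (W.erase i) k` — remove the pair.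
[cite: Charalambides2018, Ch. 2 Exercise 32; lane lemma] -/
theorem card_twoParts_filter_pair {W : Finset (Fin m)} {a : Fin m} (haW : a ∉ W) (k : ℕ) :
    ((twoParts (insert a W) (k + 1)).filter fun ρ => (blockOf ρ a).card = 2).card = ∑ i ∈ W, (twoParts (W.erase i) k).card := by
  have htarget : ((W.powersetCard 1).sigma fun s => twoParts (W \ s) k).card = ∑ i ∈ W, (twoParts (W.erase i) k).card := by
    rw [Finset.card_sigma, Finset.powersetCard_one, Finset.sum_map]
    refine Finset.sum_congr rfl fun i _ => ?_
    simp only [Function.Embedding.coeFn_mk, Finset.sdiff_singleton_eq_erase]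
  rw [← htarget]
  -- membership facts
  have hfwd : ∀ ρ ∈ (twoParts (insert a W) (k + 1)).filter (fun ρ => (blockOf ρ a).card = 2),
      (blockOf ρ a) ∈ ρ ∧ a ∈ blockOf ρ a ∧ ((blockOf ρ a).erase a ⊆ W ∧ ((blockOf ρ a).erase a).card = 1) ∧
        ρ.erase (blockOf ρ a) ∈ twoParts (W \ (blockOf ρ a).erase a) k := by
    intro ρ hρ
    rw [Finset.mem_filter, mem_twoParts] at hρ
    obtain ⟨⟨hpart, h2, hk⟩, hcard⟩ := hρ
    have hB := hpart.blockOf_mem (Finset.mem_insert_self a W)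
    have haB := hpart.mem_blockOf (Finset.mem_insert_self a W)
    refine ⟨hB, haB, ⟨fun x hx => ?_, by rw [Finset.card_erase_of_mem haB, hcard]⟩, ?_⟩
    · rw [Finset.mem_erase] at hx
      exact (Finset.mem_insert.1 (hpart.subset hB hx.2)).resolve_left hx.1
    · rw [mem_twoParts, ← insert_sdiff_eq_sdiff_erase haW haB]
      exact ⟨hpart.erase hB, fun C hC => h2 C (Finset.mem_of_mem_erase hC), by rw [Finset.card_erase_of_mem hB, hk]; rfl⟩
  have hbwd : ∀ s : Finset (Fin m), s ⊆ W → s.card = 1 → ∀ σ ∈ twoParts (W \ s) k,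
      insert (insert a s) σ ∈ twoParts (insert a W) (k + 1) ∧ insert a s ∉ σ ∧ a ∉ s ∧ blockOf (insert (insert a s) σ) a = insert a s := by
    intro s hsW hs1 σ hσ
    rw [mem_twoParts] at hσ
    obtain ⟨hσ, h2, hk⟩ := hσ
    have has : a ∉ s := fun h => haW (hsW h)
    have h1 : IsSetPartition (insert a W \ insert a s) σ := by
      rw [insert_sdiff_eq_sdiff_erase haW (Finset.mem_insert_self a s), Finset.erase_insert has]; exact hσ
    have hne : (insert a s).Nonempty := Finset.insert_nonempty _ _
    have hnot : insert a s ∉ σ := h1.notMem_of_sdiff hne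
    have hpart : IsSetPartition (insert a W) (insert (insert a s) σ) := h1.insert (Finset.insert_subset_insert _ hsW) hne
    refine ⟨mem_twoParts.2 ⟨hpart, fun D hD => ?_, by rw [Finset.card_insert_of_notMem hnot, hk]⟩, hnot, has,
      hpart.eq_blockOf (Finset.mem_insert_self _ _) (Finset.mem_insert_self _ _)⟩
    rcases Finset.mem_insert.1 hD with rfl | hD
    · rw [Finset.card_insert_of_notMem has, hs1]
    · exact h2 D hD
  refine Finset.card_nbij' (fun ρ => ⟨(blockOf ρ a).erase a, ρ.erase (blockOf ρ a)⟩) (fun d => insert (insert a d.1) d.2)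
    (fun ρ hρ => ?_) (fun d hd => ?_) (fun ρ hρ => ?_) (fun d hd => ?_)
  · rw [Finset.mem_coe] at hρ
    obtain ⟨-, -, ⟨hsW, hs1⟩, hmem⟩ := hfwd ρ hρ
    rw [Finset.mem_coe, Finset.mem_sigma, Finset.mem_powersetCard]
    exact ⟨⟨hsW, hs1⟩, hmem⟩
  · rw [Finset.mem_coe, Finset.mem_sigma, Finset.mem_powersetCard] at hd
    obtain ⟨⟨hsW, hs1⟩, hσ⟩ := hd
    obtain ⟨hmem, -, has, hblock⟩ := hbwd d.1 hsW hs1 d.2 hσ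
    rw [Finset.mem_coe, Finset.mem_filter]
    refine ⟨hmem, ?_⟩
    simp only [hblock, Finset.card_insert_of_notMem has, hs1]
  · rw [Finset.mem_coe] at hρ
    obtain ⟨hB, haB, -, -⟩ := hfwd ρ hρ
    dsimp only
    rw [Finset.insert_erase haB, Finset.insert_erase hB]
  · rw [Finset.mem_coe, Finset.mem_sigma, Finset.mem_powersetCard] at hd
    obtain ⟨⟨hsW, hs1⟩, hσ⟩ := hd
    obtain ⟨-, hnot, has, hblock⟩ := hbwd d.1 hsW hs1 d.2 hσ
    simp only [hblock, Finset.erase_insert has, Finset.erase_insert hnot]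

/-! ### The recurrence and the identification -/

open Classical in
/-- ★★ THE BLOCK-COUNT RECURRENCE: for `a ∉ W`, `#twoParts (insert a W) (k+1) = (k+1)·#twoParts W (k+1) + Σ_{i ∈ W} #twoParts (W.erase i) k`.
[cite: Charalambides2018, Ch. 2 Exercise 32 (associated Stirling numbers of the second kind); lane theorem] -/
theorem card_twoParts_insert {W : Finset (Fin m)} {a : Fin m} (haW : a ∉ W) (k : ℕ) :
    (twoParts (insert a W) (k + 1)).card = (k + 1) * (twoParts W (k + 1)).card + ∑ i ∈ W, (twoParts (W.erase i) k).card := by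
  rw [← card_twoParts_filter_three_le haW k, ← card_twoParts_filter_pair haW k, ← Finset.card_union_of_disjoint (Finset.disjoint_filter.2 fun ρ _ h h' => by omega),
    ← Finset.filter_or]
  congr 1
  ext ρ
  rw [Finset.mem_filter]
  constructor
  · intro hρ
    have h := mem_twoParts.1 hρ
    have hB := h.1.blockOf_mem (Finset.mem_insert_self a W)
    have := h.2.1 _ hB
    exact ⟨hρ, by omega⟩
  · exact fun h => h.1

/-- ★★★ `#twoParts W k = T(#W, k)`: the lane's block counts ARE the associated Stirling numbers of the second kind — (G1), (G2), (G3), (G4), … all at once.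
[cite: Charalambides2018, Ch. 2 Exercise 32 (associated Stirling numbers of the second kind)] [cite: MadrasSlade1993, Definition 1.2.4; lane theorem] -/
theorem card_twoParts_eq_assocStirling : ∀ (n : ℕ) {m : ℕ} (W : Finset (Fin m)) (k : ℕ), W.card = n → (twoParts W k).card = assocStirling n k := by
  intro n
  induction n using Nat.strong_induction_on with
  | _ n ih =>
    intro m W k hW
    rcases n with _ | n
    · rw [Finset.card_eq_zero] at hW
      subst hW
      rcases k with _ | k
      · rw [card_twoParts_zero_right, if_pos rfl, assocStirling_zero_zero]
      · rw [twoParts_eq_empty_of_lt (by rw [Finset.card_empty]; omega), Finset.card_empty, assocStirling_zero_succ]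
    · rcases k with _ | k
      · rw [card_twoParts_zero_right, if_neg (fun h => by rw [h, Finset.card_empty] at hW; omega), assocStirling_succ_zero]
      · rcases n with _ | n
        · rw [twoParts_eq_empty_of_lt (by rw [hW]; omega), Finset.card_empty, assocStirling_one_succ]
        · -- `#W = n + 2`: split off a point
          obtain ⟨a, ha⟩ : W.Nonempty := by rw [← Finset.card_pos, hW]; omega
          have hWa : (W.erase a).card = n + 1 := by rw [Finset.card_erase_of_mem ha, hW]; omega
          have hW' : W = insert a (W.erase a) := (Finset.insert_erase ha).symm
          rw [hW', card_twoParts_insert (Finset.notMem_erase a W) k, assocStirling_succ_succ, ih (n + 1) (by omega) (W.erase a) (k + 1) hWa]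
          congr 1
          rw [Finset.sum_const_nat (m := assocStirling n k) fun i hi => ih n (by omega) _ k (by rw [Finset.card_erase_of_mem hi, hWa]; omega), hWa]

/-- ★ CHECKS AND THE FIFTH-LAYER INPUTS: `T(2k, k) = (2k−1)‼`, `T(2k+1, k) = C(2k+1,3)(2k−3)‼`, `T(2k+2, k) = (G3)`, `T(2k+3, k) = (G4)` for `k ≤ 4` (the tree's closed forms), and
`T(2k+4, k) = 1, 119, 6825, 302995, 12122110` for `k = 1, …, 5`. [cite: Charalambides2018, Ch. 2 Exercise 32; lane theorem] -/
theorem assocStirling_values :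
    (∀ k, k ≤ 4 → assocStirling (2 * k) k = (2 * k - 1).doubleFactorial) ∧
    (∀ k, k ≤ 4 → assocStirling (2 * k + 1) k = (2 * k + 1).choose 3 * (2 * k - 3).doubleFactorial) ∧
    (∀ k, k ≤ 4 → assocStirling (2 * k + 2) k = (2 * k + 2).choose 4 * (2 * k - 3).doubleFactorial + 10 * (2 * k + 2).choose 6 * (2 * k - 5).doubleFactorial) ∧
    (∀ k, k ≤ 4 → assocStirling (2 * k + 3) k = (2 * k + 3).choose 5 * (2 * k - 3).doubleFactorial +
      (2 * k + 3).choose 4 * ((2 * k - 1).choose 3 * (2 * k - 5).doubleFactorial) + 280 * (2 * k + 3).choose 9 * (2 * k - 7).doubleFactorial) ∧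
    (assocStirling 6 1 = 1 ∧ assocStirling 8 2 = 119 ∧ assocStirling 10 3 = 6825 ∧ assocStirling 12 4 = 302995 ∧ assocStirling 14 5 = 12122110) := by
  refine ⟨fun k hk => ?_, fun k hk => ?_, fun k hk => ?_, fun k hk => ?_, by decide⟩ <;>
    rcases (show k = 0 ∨ k = 1 ∨ k = 2 ∨ k = 3 ∨ k = 4 by omega) with rfl | rfl | rfl | rfl | rfl <;> decide

end WordTypes

end Literature.Probability.RandomPlanarGeometry.SAW.Zd
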